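import Summits.AtomisticToContinuum.HydrodynamicLimit.Theses.AntiMazurCoboundaries
import Summits.AtomisticToContinuum.HydrodynamicLimit.Theorems.JParityClosureEvenStressEnskogExchangeable
import Literature.MathematicalPhysics.KineticTheory.HardSphereEulerProofs
import Literature.Analysis.FluidPDE.HardSphereUniqueness
import HarnessLib

/-!
# Relabelling symmetry of the hard-sphere Gibbs law jointly with the flow: two-time exchangeability
# (sub-stub `stub_relabelTwoTime`, line `cutoff-compactness-net`, crux
# `AntiMazurCoboundaries.ShearStressHalfDrude`, stmt-AtomisticToContinuum-14136)

Let `G_N = localGibbsLaw σ a₀ u₀ θ₀ N Φ` be the local Gibbs law of `N + 1` hard spheres of diameter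
`hsDiameter σ N` on the unit torus `𝕋³` and let `R_π z := z ∘ π` be the relabelling of the particles by a
permutation `π` of `Fin (N + 1)`.

* `R_π` preserves `G_N` for ALL profiles (tree: `EvenStressEnskog.measurePreserving_comp_perm_localGibbsLaw`,
  the canonical density is label-symmetric and the Liouville measure is relabelling invariant), whence the
  push-forward identity `map_comp_perm_localGibbsLaw` and one-time exchangeability
  (tree: `EvenStressEnskog.integral_comp_perm_localGibbsLaw`).
* Every hard-sphere flow commutes with `R_π` Liouville-almost everywhere
  (tree: `HardSphereFlow.flow_comp_perm_ae`, forward uniqueness of trajectories of identical spheres), hence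
  `G_N`-almost everywhere since `G_N ≪ Liouville` (`flow_comp_perm_ae_localGibbsLaw`; at all forward times
  simultaneously: `ae_forall_flow_comp_perm_of_nonneg_localGibbsLaw`).
* Combining the two: **two-time exchangeability** `∫ H(z ∘ π, (Φ_t z) ∘ π) dG_N = ∫ H(z, Φ_t z) dG_N` for
  every two-time functional `H` (`integral_twoTime_comp_perm_localGibbsLaw`; no measurability or
  integrability is needed, both sides being the junk `0` together).  The registered sub-stub
  `stub_relabelTwoTime` is its constant-profile, measurable-`H` instance.
* Consequences for the self/distinct decomposition of two-time double sums `Σᵢ Σⱼ E[F(zᵢ, (Φ_t z)ⱼ)]`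
  (all labels are equivalent, all ordered pairs of distinct labels are equivalent):
  `integral_self_twoTime_eq`, `integral_pair_twoTime_eq`, `sum_sum_integral_twoTime_eq`
  (`Σᵢⱼ = (N+1)·(self + N·distinct)`).

References: I. Gallagher, L. Saint-Raymond, B. Texier, *From Newton to Boltzmann* (2013), §1.1
(1.1.3)–(1.1.4), §4.2 (symmetry of the `N`-particle law under relabelling, preserved by the dynamics);
H. Spohn, *Large Scale Dynamics of Interacting Particles* (1991), Part I §2.3.
-/

noncomputable section

open MeasureTheory ProbabilityTheory Filter Set
open scoped ENNReal InnerProductSpace BigOperators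
open Literature.Analysis.FluidPDE Literature.MathematicalPhysics.KineticTheory

namespace Summit.AtomisticToContinuum.HydrodynamicLimit.Theorems

namespace ShearStressHalfDrudeRelabel

/-! ## The flow commutes with relabelling, `G_N`-almost everywhere -/

/-- Every hard-sphere flow commutes with the relabelling of the particles `G_N`-almost everywhere, for
the local Gibbs law `G_N` of arbitrary profiles: `Φ_t (z ∘ π) = (Φ_t z) ∘ π` for `G_N`-a.e. `z`
(`HardSphereFlow.flow_comp_perm_ae` along `G_N ≪ Liouville`). [folklore] -/
theorem flow_comp_perm_ae_localGibbsLaw (σ : ℝ) (a₀ θ₀ : T3 → ℝ) (u₀ : T3 → V3) (N : ℕ)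
    (Φ : HardSphereFlow (Torus.geometry (Fin 3)) (hsDiameter σ N) (N + 1))
    (π : Equiv.Perm (Fin (N + 1))) (t : ℝ) :
    ∀ᵐ z ∂(localGibbsLaw σ a₀ u₀ θ₀ N Φ),
      Φ.flow t (z ∘ π) = (Φ.flow t z ∘ π : Config (N + 1) (Fin 3) T3) := by
  rw [localGibbsLaw_eq]
  exact (localGibbsMeasure_absolutelyContinuous σ a₀ u₀ θ₀ N Φ).ae_le (Φ.flow_comp_perm_ae π t)

/-- Every hard-sphere flow commutes with the relabelling of the particles **at all forward times
simultaneously**, `G_N`-almost everywhere: for `G_N`-a.e. `z`, `Φ_t (z ∘ π) = (Φ_t z) ∘ π` for every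
`t ≥ 0` (forward uniqueness on the conull set of good `z` with good relabelling,
`HardSphereFlow.flow_comp_perm_of_nonneg`).  This is the form consumed by time-window functionals.
[folklore] -/
theorem ae_forall_flow_comp_perm_of_nonneg_localGibbsLaw (σ : ℝ) (a₀ θ₀ : T3 → ℝ) (u₀ : T3 → V3)
    (N : ℕ) (Φ : HardSphereFlow (Torus.geometry (Fin 3)) (hsDiameter σ N) (N + 1))
    (π : Equiv.Perm (Fin (N + 1))) :
    ∀ᵐ z ∂(localGibbsLaw σ a₀ u₀ θ₀ N Φ), ∀ t : ℝ, 0 ≤ t →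
      Φ.flow t (z ∘ π) = (Φ.flow t z ∘ π : Config (N + 1) (Fin 3) T3) := by
  rw [localGibbsLaw_eq]
  refine (localGibbsMeasure_absolutelyContinuous σ a₀ u₀ θ₀ N Φ).ae_le ?_
  filter_upwards [Φ.ae_mem_good, Φ.ae_comp_perm_mem_good π] with z hz hzπ t ht
  exact Φ.flow_comp_perm_of_nonneg π hz hzπ ht

/-! ## Relabelling invariance of the local Gibbs law and two-time exchangeability -/

/-- **Relabelling invariance of the local Gibbs law** as a push-forward identity: `(· ∘ π)_# G_N = G_N`
for all profiles `(a₀, u₀, θ₀)` (in particular for the homogeneous law of constant profiles), every `σ`,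
`N`, flow `Φ` and permutation `π` (`EvenStressEnskog.measurePreserving_comp_perm_localGibbsLaw`).
[folklore] -/
theorem map_comp_perm_localGibbsLaw (σ : ℝ) (a₀ θ₀ : T3 → ℝ) (u₀ : T3 → V3) (N : ℕ)
    (Φ : HardSphereFlow (Torus.geometry (Fin 3)) (hsDiameter σ N) (N + 1))
    (π : Equiv.Perm (Fin (N + 1))) :
    (localGibbsLaw σ a₀ u₀ θ₀ N Φ).map (fun z => (z ∘ π : Config (N + 1) (Fin 3) T3)) =
      localGibbsLaw σ a₀ u₀ θ₀ N Φ :=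
  (EvenStressEnskog.measurePreserving_comp_perm_localGibbsLaw σ a₀ θ₀ u₀ N Φ π).map_eq

/-- **Two-time exchangeability of the local Gibbs law jointly with the flow**: for all profiles, every
permutation `π` of the labels, every time `t` and EVERY two-time functional `H`,
`∫ H(z ∘ π, (Φ_t z) ∘ π) dG_N = ∫ H(z, Φ_t z) dG_N`.  The flow commutes with the relabelling `G_N`-a.e.
(`flow_comp_perm_ae_localGibbsLaw`), which turns the left integrand into `(w ↦ H(w, Φ_t w)) (z ∘ π)`, and
the relabelling preserves `G_N` (`EvenStressEnskog.integral_comp_perm_localGibbsLaw`; no measurability or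
integrability of `H` is needed). [folklore] -/
theorem integral_twoTime_comp_perm_localGibbsLaw (σ : ℝ) (a₀ θ₀ : T3 → ℝ) (u₀ : T3 → V3) (N : ℕ)
    (Φ : HardSphereFlow (Torus.geometry (Fin 3)) (hsDiameter σ N) (N + 1))
    (π : Equiv.Perm (Fin (N + 1))) (t : ℝ)
    (H : Config (N + 1) (Fin 3) T3 → Config (N + 1) (Fin 3) T3 → ℝ) :
    ∫ z, H (z ∘ π) (Φ.flow t z ∘ π) ∂(localGibbsLaw σ a₀ u₀ θ₀ N Φ) =
      ∫ z, H z (Φ.flow t z) ∂(localGibbsLaw σ a₀ u₀ θ₀ N Φ) := by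
  calc ∫ z, H (z ∘ π) (Φ.flow t z ∘ π) ∂(localGibbsLaw σ a₀ u₀ θ₀ N Φ)
      = ∫ z, H (z ∘ π) (Φ.flow t (z ∘ π)) ∂(localGibbsLaw σ a₀ u₀ θ₀ N Φ) := by
        refine integral_congr_ae ?_
        filter_upwards [flow_comp_perm_ae_localGibbsLaw σ a₀ θ₀ u₀ N Φ π t] with z hz
        rw [hz]
    _ = ∫ z, H z (Φ.flow t z) ∂(localGibbsLaw σ a₀ u₀ θ₀ N Φ) :=
        EvenStressEnskog.integral_comp_perm_localGibbsLaw σ a₀ θ₀ u₀ N Φ π fun w => H w (Φ.flow t w)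

/-- **W7 · `stub_relabelTwoTime`** (registered sub-stub of the line `cutoff-compactness-net`):
RELABELLING SYMMETRY OF THE HOMOGENEOUS GIBBS LAW JOINTLY WITH THE FLOW — for constant profiles
`(a, u₀, θ)`, every `σ`, `N`, hard-sphere flow `Φ`, permutation `π` of the `N + 1` labels, time `t` and
(measurable) two-time functional `H`,
`∫ H(j ↦ z_{π j}, j ↦ (Φ_t z)_{π j}) dG_N = ∫ H(z, Φ_t z) dG_N`.  Instance of
`integral_twoTime_comp_perm_localGibbsLaw` (where neither constancy of the profiles nor measurability of
`H` is used). [folklore] -/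
theorem stub_relabelTwoTime :
    ∀ (σ a θ : ℝ) (u₀ : V3) (N : ℕ)
      (Φ : HardSphereFlow (Torus.geometry (Fin 3)) (hsDiameter σ N) (N + 1)) (π : Equiv.Perm (Fin (N + 1)))
      (t : ℝ) (H : Config (N + 1) (Fin 3) T3 → Config (N + 1) (Fin 3) T3 → ℝ),
      Measurable (Function.uncurry H) →
      ∫ z, H (fun j => z (π j)) (fun j => Φ.flow t z (π j))
          ∂(localGibbsLaw σ (fun _ => a) (fun _ => u₀) (fun _ => θ) N Φ) =
        ∫ z, H z (Φ.flow t z) ∂(localGibbsLaw σ (fun _ => a) (fun _ => u₀) (fun _ => θ) N Φ) :=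
  fun σ a θ u₀ N Φ π t H _ =>
    integral_twoTime_comp_perm_localGibbsLaw σ (fun _ => a) (fun _ => θ) (fun _ => u₀) N Φ π t H

/-! ## Self/distinct decomposition of two-time double sums -/

/-- **All labels are equivalent** (two-time form): `∫ F(zᵢ, (Φ_t z)ᵢ) dG_N = ∫ F(z_k, (Φ_t z)_k) dG_N`
for all labels `i, k` (two-time exchangeability along the transposition of `i` and `k`). [folklore] -/
theorem integral_self_twoTime_eq (σ : ℝ) (a₀ θ₀ : T3 → ℝ) (u₀ : T3 → V3) (N : ℕ)
    (Φ : HardSphereFlow (Torus.geometry (Fin 3)) (hsDiameter σ N) (N + 1)) (t : ℝ)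
    (F : T3 × V3 → T3 × V3 → ℝ) (i k : Fin (N + 1)) :
    ∫ z, F (z i) (Φ.flow t z i) ∂(localGibbsLaw σ a₀ u₀ θ₀ N Φ) =
      ∫ z, F (z k) (Φ.flow t z k) ∂(localGibbsLaw σ a₀ u₀ θ₀ N Φ) := by
  have h := integral_twoTime_comp_perm_localGibbsLaw σ a₀ θ₀ u₀ N Φ (Equiv.swap k i) t
    fun z w => F (z k) (w k)
  simpa only [Function.comp_apply, Equiv.swap_apply_left] using h

/-- **All ordered pairs of distinct labels are equivalent** (two-time form): for `i ≠ j` and `k ≠ l`,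
`∫ F(zᵢ, (Φ_t z)ⱼ) dG_N = ∫ F(z_k, (Φ_t z)_l) dG_N` (two-time exchangeability along a permutation `π`
with `π k = i`, `π l = j`, a product of two transpositions). [folklore] -/
theorem integral_pair_twoTime_eq (σ : ℝ) (a₀ θ₀ : T3 → ℝ) (u₀ : T3 → V3) (N : ℕ)
    (Φ : HardSphereFlow (Torus.geometry (Fin 3)) (hsDiameter σ N) (N + 1)) (t : ℝ)
    (F : T3 × V3 → T3 × V3 → ℝ) {i j k l : Fin (N + 1)} (hij : i ≠ j) (hkl : k ≠ l) :
    ∫ z, F (z i) (Φ.flow t z j) ∂(localGibbsLaw σ a₀ u₀ θ₀ N Φ) =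
      ∫ z, F (z k) (Φ.flow t z l) ∂(localGibbsLaw σ a₀ u₀ θ₀ N Φ) := by
  obtain ⟨π, hπk, hπl⟩ : ∃ π : Equiv.Perm (Fin (N + 1)), π k = i ∧ π l = j := by
    have hjk : Equiv.swap k i j ≠ k := fun h => hij (by
      have h' := congrArg (Equiv.swap k i) h
      rwa [Equiv.swap_apply_self, Equiv.swap_apply_left, eq_comm] at h')
    refine ⟨(Equiv.swap l (Equiv.swap k i j)).trans (Equiv.swap k i), ?_, ?_⟩
    · rw [Equiv.trans_apply, Equiv.swap_apply_of_ne_of_ne hkl hjk.symm, Equiv.swap_apply_left]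
    · rw [Equiv.trans_apply, Equiv.swap_apply_left, Equiv.swap_apply_self]
  have h := integral_twoTime_comp_perm_localGibbsLaw σ a₀ θ₀ u₀ N Φ π t fun z w => F (z k) (w l)
  simpa only [Function.comp_apply, hπk, hπl] using h

/-- **Self/distinct decomposition**: for every two-point functional `F` of one initial and one evolved
particle, `Σᵢ Σⱼ ∫ F(zᵢ, (Φ_t z)ⱼ) dG_N = (N + 1) · (∫ F(z₀, (Φ_t z)₀) dG_N + N · ∫ F(z₀, (Φ_t z)₁) dG_N)`
(all `N + 1` diagonal terms equal the self term, all `(N + 1) N` off-diagonal terms equal the distinct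
term; for `N = 0` there is no off-diagonal term and the coefficient `N` vanishes). [folklore] -/
theorem sum_sum_integral_twoTime_eq (σ : ℝ) (a₀ θ₀ : T3 → ℝ) (u₀ : T3 → V3) (N : ℕ)
    (Φ : HardSphereFlow (Torus.geometry (Fin 3)) (hsDiameter σ N) (N + 1)) (t : ℝ)
    (F : T3 × V3 → T3 × V3 → ℝ) :
    ∑ i, ∑ j, ∫ z, F (z i) (Φ.flow t z j) ∂(localGibbsLaw σ a₀ u₀ θ₀ N Φ) =
      ((N : ℝ) + 1) * (∫ z, F (z 0) (Φ.flow t z 0) ∂(localGibbsLaw σ a₀ u₀ θ₀ N Φ) +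
        (N : ℝ) * ∫ z, F (z 0) (Φ.flow t z 1) ∂(localGibbsLaw σ a₀ u₀ θ₀ N Φ)) := by
  have hinner : ∀ i : Fin (N + 1),
      ∑ j, ∫ z, F (z i) (Φ.flow t z j) ∂(localGibbsLaw σ a₀ u₀ θ₀ N Φ) =
        ∫ z, F (z 0) (Φ.flow t z 0) ∂(localGibbsLaw σ a₀ u₀ θ₀ N Φ) +
          (N : ℝ) * ∫ z, F (z 0) (Φ.flow t z 1) ∂(localGibbsLaw σ a₀ u₀ θ₀ N Φ) := by
    intro i
    rw [← Finset.add_sum_erase _ _ (Finset.mem_univ i),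
      integral_self_twoTime_eq σ a₀ θ₀ u₀ N Φ t F i 0]
    congr 1
    have hpair : ∀ j ∈ (Finset.univ : Finset (Fin (N + 1))).erase i,
        ∫ z, F (z i) (Φ.flow t z j) ∂(localGibbsLaw σ a₀ u₀ θ₀ N Φ) =
          ∫ z, F (z 0) (Φ.flow t z 1) ∂(localGibbsLaw σ a₀ u₀ θ₀ N Φ) := by
      intro j hj
      have hji : j ≠ i := Finset.ne_of_mem_erase hj
      -- there is a label `j ≠ i`, so `N ≠ 0` and `0 ≠ 1` in `Fin (N + 1)`
      have hN : NeZero N := ⟨by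
        rintro rfl
        exact hji (Fin.ext (by have := j.isLt; have := i.isLt; omega))⟩
      exact integral_pair_twoTime_eq σ a₀ θ₀ u₀ N Φ t F hji.symm Fin.zero_ne_one'
    rw [Finset.sum_congr rfl hpair, Finset.sum_const, nsmul_eq_mul,
      Finset.card_erase_of_mem (Finset.mem_univ i), Finset.card_univ, Fintype.card_fin,
      Nat.add_sub_cancel]
  simp only [hinner, Finset.sum_const, Finset.card_univ, Fintype.card_fin, nsmul_eq_mul, Nat.cast_add,
    Nat.cast_one]

end ShearStressHalfDrudeRelabel

end Summit.AtomisticToContinuum.HydrodynamicLimit.Theorems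

end
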